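import Summits.BirchSwinnertonDyer.Rank1Residual.P2.CongruentNumberCor515SelmerEight
import Summits.BirchSwinnertonDyer.Rank1Residual.P2.CongruentNumberEvenMonskyLawDescent
import Summits.BirchSwinnertonDyer.Rank1Residual.P2.CongruentNumberSilentEvenFiveEnclosureAut
import Summits.BirchSwinnertonDyer.Rank1Residual.P2.CongruentNumberPairsAtTwoGenusPointData
import Literature.NumberTheory.EllipticCurves.Tian2014.ClassSixFamilyDescentProofs
import Literature.NumberTheory.EllipticCurves.Tian2014.CMPointSystemGaloisGeneration
import Literature.NumberTheory.QuadraticFields.RedeiReichardtFourRank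
import HarnessLib

/-!
# Cell `bsd-monsky`, route A: MONSKY 1990 COR. 5.15 + REMARK (2) (the named fact `h515`) AS A THEOREM RELATIVE TO THE
# LANE'S THREE STANDARD DISPLAYS — `{tyz_genusPointData, GZK, tian2014_system_sMinus_aut}` ⟹ `h515`, family by family

HONEST FRAMING (cell `bsd-monsky`, run/shared/lean/pub/bsd-monsky/; README §1): ONE theorem on ONE explicit infinite
family at the prime `2`; nothing is booked by this file; no mark moved. The tree's named fact
`Monsky1990.cor515_rank_eq_one_and_card_selmerGroup_two` (`h515`: rank exactly `1` and `#Sel⁽²⁾ = 8` on the twelve families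
of Cor. 5.15) had, until `P2/CongruentNumberCor515SelmerEight.lean`, no kernel derivation: its Selmer clause is now a theorem
there (Remark (2)'s «`S̄ = ℤ/2`»), and `h515 ⟺` «every member is a congruent number» (Cor. 5.15 as printed). THIS FILE
derives the rank clause — «`E^{(N)}_ℚ` has rank `1`» — on every family from the displayed inputs the P2 lane already
carries, so that `h515` is a THEOREM relative to them:

* the odd families `p₅, p₇` and `p₃p₇, p₃p₅, p₁p₅ ((p₁/p₅) = −1), p₁p₇ ((p₁/p₇) = −1)`: Tian–Yuan–Zhang's criterion through
  DOOR A (`rankOne_sha_bsdp_two_congruentNumberCurve_{prime_five_or_seven, odd_pair}`, modulo `{hTYZ, hGZK}` — Monsky's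
  odd formula and Rédei–Reichardt are tree theorems);
* the even families `2p₃, 2p₇`, `2p₁p₃, 2p₁p₇ ((p₁/q) = −1)` and the LOUD half `2p₅q₃ ((p/q) = +1)`: `Σ₂′` odd (kernel,
  mod RR discharged) and DOOR B6 over census vocabulary (`…_two_mul_prod_of_odd_genusSum₂'_descent`, modulo `{U⁺, hGZK}`,
  U⁺ = `uPlus_of_genusPointData hTYZ hGZK`);
* the SILENT half `2p₅q₃ ((p/q) = −1)` = `𝒮⁻`: route A's display `hSys⁷` alone (`mordellWeilRank_eq_one_of_autSystem_rankDescent`).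

Main theorems: `mordellWeilRank_eq_one_of_isCor515Family_of_displays (hTYZ) (hGZK) (hSys)` and
**`cor515_rank_eq_one_and_card_selmerGroup_two_of_displays (hTYZ) (hGZK) (hSys) : h515`**; with the equivalence of
`…Cor515SelmerEight.lean`, also **Cor. 5.15 as printed** («The following are all congruent numbers») relative to the same
three displays (`forall_isCongruentNumber_of_isCor515Family_of_displays`). Bookkeeping consequence for the lane: every
landed door taking `h515` as a binder can be fed `cor515_rank_eq_one_and_card_selmerGroup_two_of_displays`, i.e. `h515` is
no longer an independent displayed input next to `{hTYZ, hGZK, hSys}`. CONDITIONAL on the three displays; nothing asserted;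
no new named fact; no `_holds`.

References: [Monsky1990MockHeegner] Cor. 5.15 (p. 66), Remark (2) (p. 67); [TianYuanZhang2017] Thm. 1.2, Thm. 3.5, §1 (1.1);
[Tian2014] Thm. 2.8 (J132), Prop. 2.1 (J124–J126); [HeathBrown1994SelmerCongruentII] Appendix (Monsky) pp. 39–41;
[LiMa2008] Thm. 0.4; [Lagrange1975] §11 table p. 16-12.
-/

noncomputable section

open scoped Classical

open WeierstrassCurve Literature.NumberTheory.EllipticCurves
  Literature.NumberTheory.EllipticCurves.HeathBrown1994
  Literature.NumberTheory.EllipticCurves.Monsky1990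
  Literature.NumberTheory.EllipticCurves.MonskySelmerParity
  Literature.NumberTheory.EllipticCurves.Rank1Residual.Typed
  Literature.NumberTheory.EllipticCurves.Tian2014
  Literature.NumberTheory.EllipticCurves.TianYuanZhang2017
  Literature.NumberTheory.QuadraticFields.RedeiReichardt

set_option autoImplicit false

namespace Summit.BirchSwinnertonDyer.Rank1Residual.P2

/-! ## §1 The rank clause family by family -/

/-- **Rank one on the odd two-prime families of Cor. 5.15** (`p₃p₇, p₃p₅, p₁p₅, p₁p₇` with the symbol condition), from
`{hTYZ, hGZK}`: DOOR A on the odd pair table (`s(pq) = 1`) — `rankOne_sha_bsdp_two_congruentNumberCurve_odd_pair` with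
Monsky's odd formula and Rédei–Reichardt discharged. [cite: TianYuanZhang2017, Thm. 1.2, Thm. 3.5 and §1 (1.1)]
[cite: HeathBrown1994SelmerCongruentII, Appendix (Monsky), typescript p. 39 L10–L33] [cite: Monsky1990MockHeegner, Cor. 5.15 (2)–(3) (p. 66)] -/
theorem mordellWeilRank_eq_one_odd_pair_of_displays (hTYZ : tyz_genusPointData)
    (hGZK : rank_eq_analyticRank_of_analyticRank_le_one) {p q : ℕ} (hp : p.Prime) (hq : q.Prime) (hp2 : p ≠ 2)
    (hq2 : q ≠ 2) (hne : p ≠ q) (h8 : (p * q) % 8 = 5 ∨ (p * q) % 8 = 7)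
    (hsym : ¬ (jacobiSym p q = 1 ∧ (q % 8 = 1 ∨ p % 8 = 1))) :
    (congruentNumberCurve (p * q)).mordellWeilRank = 1 := by
  have ht : ∀ i, (![q, p] i).Prime := fun i => by fin_cases i <;> assumption
  have ht2 : ∀ i, (![q, p] i) ≠ 2 := fun i => by fin_cases i <;> assumption
  have hinj : Function.Injective ![q, p] := by
    intro i j hij
    fin_cases i <;> fin_cases j
    · rfl
    · exact absurd hij.symm hne
    · exact absurd hij hne
    · rfl
  have h8' : ((![q, p] : Fin 2 → ℕ) 0 * (![q, p] : Fin 2 → ℕ) 1) % 8 = 5 ∨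
      ((![q, p] : Fin 2 → ℕ) 0 * (![q, p] : Fin 2 → ℕ) 1) % 8 = 7 := by
    simpa only [Matrix.cons_val_zero, Matrix.cons_val_one, mul_comm q p] using h8
  have hs : monskySelmerRankOdd ![q, p] = 1 := by
    rw [monskySelmerRankOdd_pair_eq_one_iff _ ht ht2 hinj h8']
    simpa only [Matrix.cons_val_zero, Matrix.cons_val_one] using hsym
  have hprod : (∏ i, (![q, p] : Fin 2 → ℕ) i) = p * q := by
    rw [Fin.prod_univ_two]
    simp only [Matrix.cons_val_zero, Matrix.cons_val_one]
    exact mul_comm q p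
  exact (rankOne_sha_bsdp_two_congruentNumberCurve_odd_pair hTYZ hGZK monsky_card_selmerGroup_two_odd_holds
    redeiReichardt_fourTwoCard_classGroup_holds ![q, p] ht hinj hprod h8 hs).2.1

/-- **Rank one on `2p₃` and `2p₇`** from `{hTYZ, hGZK}`: `Σ₂′(2p)` is odd (Tian's class-`6` family at `k = 0`, mod RR
discharged) and `s(2p) = 1` (Heath-Brown's table), so DOOR B6 over census vocabulary applies.
[cite: TianYuanZhang2017, Thm. 1.2 (the second sum), Thm. 3.5] [cite: HeathBrown1994SelmerCongruentII, §1 typescript p. 6 L26–L28]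
[cite: Monsky1990MockHeegner, Cor. 5.15 (1) (p. 66)] -/
theorem mordellWeilRank_eq_one_two_mul_prime_of_displays (hTYZ : tyz_genusPointData)
    (hGZK : rank_eq_analyticRank_of_analyticRank_le_one) {p : ℕ} (hp : p.Prime) (h8 : p % 8 = 3 ∨ p % 8 = 7) :
    (congruentNumberCurve (2 * p)).mordellWeilRank = 1 := by
  have hp2 : p ≠ 2 := by omega
  have hp' : ∀ i, ((![p] : Fin 1 → ℕ) i).Prime := fun i => by fin_cases i; exact hp
  have hinj : Function.Injective (![p] : Fin 1 → ℕ) := Function.injective_of_subsingleton _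
  have hn : 2 * ∏ i, (![p] : Fin 1 → ℕ) i = 2 * p := by rw [prod_vecSingle]
  have h6 : (2 * p) % 8 = 6 := by omega
  have hs : monskySelmerRankEven ![p] = 1 := by
    rw [monskySelmerRankEven_prime hp hp2, if_neg (by omega), if_neg (by omega)]
  -- `Σ₂′(2p)` odd: Tian's class-`6` family with no prime `≡ 1 (mod 8)` (the Legendre matrix is `(0)`)
  have hgen : Odd (genusSum₂' (2 * p) fun d => genusClassNumber (GenusField d)) := by
    have hone : ∀ i : Fin (0 + 1), i = 0 := fun i => Fin.ext (Nat.lt_one_iff.mp i.isLt)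
    refine odd_genusSum₂'_two_mul_caseSix (k := 0) ![p] redeiReichardt_fourTwoCard_classGroup_holds hp' hinj
      (by show p % 4 = 3; omega) (fun i hi => absurd (hone i) hi) ?_ prod_vecSingle
    intro v _
    have hcases : ∀ x : ZMod 2, x = 0 ∨ x = 1 := by decide
    rcases hcases (v 0) with h0 | h1
    · left
      funext i
      rw [hone i]
      exact h0
    · right
      funext i
      rw [hone i]
      exact h1
  exact (Conjectures.rankOne_sha_bsdp_two_congruentNumberCurve_two_mul_prod_of_odd_genusSum₂'_descent
    (uPlus_of_genusPointData hTYZ hGZK) hGZK ![p] hp' hinj hn h6 hs hgen).2.1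

/-- **Rank one on `2p₁p₃` and `2p₁p₇` with `(p₁/q) = −1`** from `{hTYZ, hGZK}`: `Σ₂′(2pq)` odd (the class-`6` pair, mod RR
discharged), `s(2pq) = 1`, DOOR B6 over census vocabulary. [cite: TianYuanZhang2017, Thm. 1.2, Thm. 3.5]
[cite: HeathBrown1994SelmerCongruentII, Appendix (Monsky), typescript p. 41 L20–L36] [cite: Monsky1990MockHeegner, Cor. 5.15 (3) (p. 66)] -/
theorem mordellWeilRank_eq_one_two_mul_one_pair_of_displays (hTYZ : tyz_genusPointData)
    (hGZK : rank_eq_analyticRank_of_analyticRank_le_one) {p q : ℕ} (hp : p.Prime) (hq : q.Prime) (hp1 : p % 8 = 1)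
    (hq4 : q % 4 = 3) (hj : jacobiSym p q = -1) :
    (congruentNumberCurve (2 * (p * q))).mordellWeilRank = 1 := by
  have hne : p ≠ q := fun h => by omega
  have ht : ∀ i, (![p, q] i).Prime := fun i => by fin_cases i <;> assumption
  have hinj : Function.Injective ![p, q] := by
    intro i j hij
    fin_cases i <;> fin_cases j
    · rfl
    · exact absurd hij hne
    · exact absurd hij.symm hne
    · rfl
  have hn : 2 * ∏ i, (![p, q] : Fin 2 → ℕ) i = 2 * (p * q) := by rw [Fin.prod_univ_two]; rfl
  have h6 : (2 * (p * q)) % 8 = 6 := by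
    have : (p * q) % 4 = 3 := by rw [Nat.mul_mod, show p % 4 = 1 by omega, hq4]
    omega
  exact (Conjectures.rankOne_sha_bsdp_two_congruentNumberCurve_two_mul_prod_of_odd_genusSum₂'_descent
    (uPlus_of_genusPointData hTYZ hGZK) hGZK ![p, q] ht hinj hn h6
    (monskySelmerRankEven_one_pair_of_jacobiSym_eq_neg_one hp hq hp1 hq4 hj).1
    (odd_genusSum₂'_genusField_two_mul_one_pair redeiReichardt_fourTwoCard_classGroup_holds hp hq hp1 hq4 hj)).2.1

/-- **Rank one on the LOUD half of `2p₅q₃`** (`(p/q) = +1`) from `{hTYZ, hGZK}`: `Σ₂′(2pq)` odd (mod RR discharged),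
`s(2pq) = 1`, DOOR B6 over census vocabulary. [cite: TianYuanZhang2017, Thm. 1.2, Thm. 3.5]
[cite: HeathBrown1994SelmerCongruentII, Appendix (Monsky), typescript p. 41 L20–L36] [cite: Monsky1990MockHeegner, Cor. 5.15 (2) (p. 66)] -/
theorem mordellWeilRank_eq_one_two_mul_five_mul_plus_of_displays (hTYZ : tyz_genusPointData)
    (hGZK : rank_eq_analyticRank_of_analyticRank_le_one) {p q : ℕ} (hp : p.Prime) (hq : q.Prime)
    (hp5 : p % 8 = 5) (hq4 : q % 4 = 3) (hj : jacobiSym p q = 1) :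
    (congruentNumberCurve (2 * (p * q))).mordellWeilRank = 1 := by
  have hne : p ≠ q := fun h => by omega
  have ht : ∀ i, (![p, q] i).Prime := fun i => by fin_cases i <;> assumption
  have hinj : Function.Injective ![p, q] := by
    intro i j hij
    fin_cases i <;> fin_cases j
    · rfl
    · exact absurd hij hne
    · exact absurd hij.symm hne
    · rfl
  have hn : 2 * ∏ i, (![p, q] : Fin 2 → ℕ) i = 2 * (p * q) := by rw [Fin.prod_univ_two]; rfl
  have h6 : (2 * (p * q)) % 8 = 6 := by
    have : (p * q) % 4 = 3 := by rw [Nat.mul_mod, show p % 4 = 1 by omega, hq4]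
    omega
  exact (Conjectures.rankOne_sha_bsdp_two_congruentNumberCurve_two_mul_prod_of_odd_genusSum₂'_descent
    (uPlus_of_genusPointData hTYZ hGZK) hGZK ![p, q] ht hinj hn h6 (monskySelmerRankEven_five_pair hp hq hp5 hq4)
    (odd_genusSum₂'_genusField_two_mul_five_mul redeiReichardt_fourTwoCard_classGroup_holds hp hq hp5 hq4 hj)).2.1

/-! ## §2 The rank clause on all twelve families, and `h515` relative to the three displays -/

/-- **«`E^{(N)}_ℚ` has rank exactly one» on ALL twelve Cor. 5.15 families, relative to `{hTYZ, hGZK, hSys⁷}`**: the odd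
families and the loud even cells through Tian–Yuan–Zhang's criterion + GZK, the silent half `𝒮⁻` of `2p₅q₃` through
route A's CM-point system display alone. CONDITIONAL; nothing asserted.
[cite: Monsky1990MockHeegner, Cor. 5.15 (p. 66), Remark (2) (p. 67)] [cite: TianYuanZhang2017, Thm. 1.2, Thm. 3.5]
[cite: Tian2014, Thm. 2.8 (J132), Prop. 2.1 (J124–J126)] [cite: Lagrange1975, §11 table p. 16-12] -/
theorem mordellWeilRank_eq_one_of_isCor515Family_of_displays (hTYZ : tyz_genusPointData)
    (hGZK : rank_eq_analyticRank_of_analyticRank_le_one) (hSys : tian2014_system_sMinus_aut) {N : ℕ}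
    (hN : IsCor515Family N) : (congruentNumberCurve N).mordellWeilRank = 1 := by
  rcases hN with ⟨hN, h8⟩ | ⟨p, hp, hp8, rfl⟩ | ⟨p, q, hp, hq, hp8, hq8, rfl⟩ | ⟨p, q, hp, hq, hp8, hq8, rfl⟩ |
      ⟨p, q, hp, hq, hp8, hq8, hj, rfl⟩ | ⟨p, q, hp, hq, hp8, hq8, hj, rfl⟩
  · -- `p₅`, `p₇`
    exact (rankOne_sha_bsdp_two_congruentNumberCurve_prime_five_or_seven hTYZ hGZK
      monsky_card_selmerGroup_two_odd_holds redeiReichardt_fourTwoCard_classGroup_holds hN h8).2.1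
  · -- `2p₃`, `2p₇`
    exact mordellWeilRank_eq_one_two_mul_prime_of_displays hTYZ hGZK hp hp8
  · -- `p₃p₇`, `p₃p₅`
    refine mordellWeilRank_eq_one_odd_pair_of_displays hTYZ hGZK hp hq (by omega) (by omega) (by omega) ?_ ?_
    · rw [Nat.mul_mod, hp8]
      rcases hq8 with hq8 | hq8 <;> rw [hq8] <;> decide
    · rintro ⟨-, h1 | h1⟩ <;> omega
  · -- `2p₃p₅`, `2p₅p₇`: the loud half by TYZ + GZK, the silent half `𝒮⁻` by route A's display
    have hne : p ≠ q := fun h => by omega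
    rcases jacobiSym_eq_one_or_eq_neg_one_of_prime_ne hp hq hne with hj | hj
    · exact mordellWeilRank_eq_one_two_mul_five_mul_plus_of_displays hTYZ hGZK hp hq hp8 (by omega) hj
    · exact mordellWeilRank_eq_one_of_autSystem_rankDescent hSys p q hp hq hp8 (by omega) hj
  · -- `p₁p₅`, `p₁p₇` with `(p₁/q) = −1`
    refine mordellWeilRank_eq_one_odd_pair_of_displays hTYZ hGZK hp hq (by omega) (by omega) (by omega) ?_ ?_
    · rw [Nat.mul_mod, hp8]
      rcases hq8 with hq8 | hq8 <;> rw [hq8] <;> decide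
    · rintro ⟨h1, -⟩
      rw [hj] at h1
      norm_num at h1
  · -- `2p₁p₇`, `2p₁p₃` with `(p₁/q) = −1`
    exact mordellWeilRank_eq_one_two_mul_one_pair_of_displays hTYZ hGZK hp hq hp8 (by omega) hj

/-- **`h515` IS A THEOREM RELATIVE TO THE LANE'S THREE DISPLAYS**: `Monsky1990.cor515_rank_eq_one_and_card_selmerGroup_two`
(rank exactly `1` and `#Sel⁽²⁾ = 8` on the twelve families of Cor. 5.15) from `{tyz_genusPointData, GZK,
tian2014_system_sMinus_aut}` — the Selmer clause unconditionally (`…Cor515SelmerEight.lean`), the rank clause by §2.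
Every landed door with an `h515` binder can be fed this theorem. CONDITIONAL; nothing asserted; no named fact discharged by
name (the displays remain displays). [cite: Monsky1990MockHeegner, Cor. 5.15 (p. 66), Remark (2) (p. 67)]
[cite: TianYuanZhang2017, Thm. 1.2, Thm. 3.5] [cite: Tian2014, Thm. 2.8 (J132), Prop. 2.1 (J124–J126)] -/
theorem cor515_rank_eq_one_and_card_selmerGroup_two_of_displays (hTYZ : tyz_genusPointData)
    (hGZK : rank_eq_analyticRank_of_analyticRank_le_one) (hSys : tian2014_system_sMinus_aut) :
    cor515_rank_eq_one_and_card_selmerGroup_two := by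
  intro N _ hN
  exact ⟨mordellWeilRank_eq_one_of_isCor515Family_of_displays hTYZ hGZK hSys hN,
    card_selmerGroup_two_eq_eight_of_isCor515Family hN⟩

/-- **Cor. 5.15 AS PRINTED relative to the three displays**: «The following are all congruent numbers» — every member of
the twelve families is a congruent number. CONDITIONAL; nothing asserted.
[cite: Monsky1990MockHeegner, Cor. 5.15 (p. 66)] [cite: TopYui2008Congruent, Prop. 3.3 (i) ⟺ (iv)] -/
theorem forall_isCongruentNumber_of_isCor515Family_of_displays (hTYZ : tyz_genusPointData)
    (hGZK : rank_eq_analyticRank_of_analyticRank_le_one) (hSys : tian2014_system_sMinus_aut) :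
    ∀ N : ℕ, IsCor515Family N → IsCongruentNumber N :=
  cor515_rank_eq_one_and_card_selmerGroup_two_iff_forall_isCongruentNumber.mp
    (cor515_rank_eq_one_and_card_selmerGroup_two_of_displays hTYZ hGZK hSys)

/-- **`Ш(E_N)[2^∞] = 0` on all twelve Cor. 5.15 families relative to the three displays** (the landed consequence
`primaryComponent_sha_two_eq_bot_of_cor515` fed the derived `h515`). CONDITIONAL; nothing asserted.
[cite: Monsky1990MockHeegner, Remark (2) (p. 67)] [cite: SilvermanAEC2009, Thm. X.4.2] -/
theorem primaryComponent_sha_two_eq_bot_of_isCor515Family_of_displays (hTYZ : tyz_genusPointData)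
    (hGZK : rank_eq_analyticRank_of_analyticRank_le_one) (hSys : tian2014_system_sMinus_aut) {N : ℕ}
    (hN : IsCor515Family N) :
    haveI := isElliptic_congruentNumberCurve hN.ne_zero
    AddCommGroup.primaryComponent (congruentNumberCurve N).sha 2 = ⊥ :=
  primaryComponent_sha_two_eq_bot_of_cor515 (cor515_rank_eq_one_and_card_selmerGroup_two_of_displays hTYZ hGZK hSys) hN

/-! ## §3 The corner of record after referee B ROUND 742: the reduced display `hSys⁸` (append, 2026-08-27) -/

/-- **`h515` relative to `{hTYZ, hGZK, hSys⁸}`** — the route-A corner of record since referee B ROUND 742 is the REDUCED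
display `tian2014_system_sMinus_autReduced` (`hSys⁸`, `Tian2014/CMPointSystemGaloisGeneration.lean`), equivalent to `hSys⁷`
(`tian2014_system_sMinus_aut_of_autReduced`); the twin of `cor515_rank_eq_one_and_card_selmerGroup_two_of_displays`. CONDITIONAL;
nothing asserted. [cite: Monsky1990MockHeegner, Cor. 5.15 (p. 66), Remark (2) (p. 67)] [cite: TianYuanZhang2017, Thm. 1.2, Thm. 3.5]
[cite: Tian2014, Thm. 2.8 (J132), Prop. 2.1 (J124–J126), Notations (i)–(iii) (J122–J123)] -/
theorem cor515_rank_eq_one_and_card_selmerGroup_two_of_displays_reduced (hTYZ : tyz_genusPointData)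
    (hGZK : rank_eq_analyticRank_of_analyticRank_le_one) (hSys : tian2014_system_sMinus_autReduced) :
    cor515_rank_eq_one_and_card_selmerGroup_two :=
  cor515_rank_eq_one_and_card_selmerGroup_two_of_displays hTYZ hGZK (tian2014_system_sMinus_aut_of_autReduced hSys)

/-- **Cor. 5.15 as printed relative to `{hTYZ, hGZK, hSys⁸}`.** CONDITIONAL; nothing asserted.
[cite: Monsky1990MockHeegner, Cor. 5.15 (p. 66)] [cite: TopYui2008Congruent, Prop. 3.3 (i) ⟺ (iv)] -/
theorem forall_isCongruentNumber_of_isCor515Family_of_displays_reduced (hTYZ : tyz_genusPointData)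
    (hGZK : rank_eq_analyticRank_of_analyticRank_le_one) (hSys : tian2014_system_sMinus_autReduced) :
    ∀ N : ℕ, IsCor515Family N → IsCongruentNumber N :=
  forall_isCongruentNumber_of_isCor515Family_of_displays hTYZ hGZK (tian2014_system_sMinus_aut_of_autReduced hSys)

end Summit.BirchSwinnertonDyer.Rank1Residual.P2

end
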